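import Mathlib
import HarnessLib
import Summits.Ventures.LatticeQCDFlow.Scaling.TiltedProtocolMass
import Summits.Ventures.LatticeQCDFlow.Scaling.HypercontractiveDeviation
import Summits.Ventures.LatticeQCDFlow.Scaling.PathWorkMoments

/-!
# HypercontractiveTiltedMass — the `t`-tilted mass of the uniform switching protocol for
# HYPERCONTRACTIVE layers: the two step coefficients are equilibrium log-MGFs of the family, and
# `|ν_n^{(t)}| ≤ p_n^{(t)}·exp(n·s·a/(1−θ))` with `s = √(e^{t²ε}−1)`, `a = ρ√(e^{(t−1)²ε}−1)`,
# `θ = ρ·e^{(6t²−8t+3)ε/4}`, `ε = σ̄²/n²` — NO oscillation (`ΔD`) hypothesis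

HONEST FRAMING: exact (Metropolis-corrected) sampling algorithms for lattice gauge theory;
figures of merit are autocorrelation/cost numbers at stated couplings and volumes; no
continuum-physics claim.

Venture `LatticeQCDFlow` (cell pub-lqcd), topic `Scaling`; FANOUT row 19 (`su2-snf`, GEN-10).
OUR WORK (elementary finite sums), nothing cited as a fact.  Setting: finite configuration space,
`S_c = S₀ + c•D`, uniform grid `c_k = k/n`, POSITIVE layers `P k` with unit row sums leaving
`π_{(k+1)/n}` invariant and HYPERCONTRACTIVE towards it with constant `ρ ≥ 0` (`HyperContracts`,
`Scaling/HypercontractiveDeviation`); `Var_c(D) ≤ σ̄²` for all `c`.  Vocabulary of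
`Scaling/TiltedProtocolMass` (`tWeight`, `tTiltLaw`, `tPerfMass`, `stepLogMGF = Λ`).

* §0 HOW `ρ < 1` ARISES (`HyperContracts.of_comp`, model-free): a layer that `χ²`-contracts
  zero-mass deviations by `λ` FOLLOWED by a fully hypercontractive one
  (`‖K₂‖_{L²(1/π)→L⁴(π)} ≤ 1`, the tensorising property) satisfies `HyperContracts (K₁K₂) π λ` —
  `m − m₀` contracting sweeps then `m₀` hypercontractive ones give `ρ = λ^{m−m₀}`;
* §1 THE STEP COEFFICIENTS ARE EQUILIBRIUM LOG-MGFs: `exp_stepLogMGF_two`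
  (`e^{Λ_{c,a}(2)} = Z(c+2a)Z(c)/Z(c+a)²`), `gibbsLaw_div_gibbsLaw_linAction`,
  **`sum_tWeight_pow_four_eq(_exp)`** — the Hölder coefficient of the tilt step,
  `Σ_x g_k⁴π_k³/π_{k+1}² = (Z(c_{k+1})/Z(c_k))²·Z(c_k+(4t−2)δ)/Z(c_k)
  = ḡ_k⁴·e^{2Λ_{c_{k+1},(t−1)δ}(2) + Λ_{c_k,(2t−1)δ}(2)}` (a free-energy second difference), hence
  **`sqrt_sqrt_sum_tWeight_pow_four_le`**: `(Σ…)^{1/4} ≤ ḡ_k·e^{(6t²−8t+3)δ²σ̄²/4}`; the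
  tilt-induced `χ²(π_{c_k+tδ} ‖ π_{c_{k+1}}) ≤ e^{(t−1)²δ²σ̄²} − 1` and the mass step are
  `Scaling/TiltedProtocolMass`;
* §2 `isStationary_exp_neg_of_gibbsLaw` and **`tTiltMass_uniform_le_hc`**: the normalised pair
  `(m_k, dev4_k)/p_k` obeys the 2×2 majorant system of `Scaling/TiltedMarginals`
  (`coupled_majorant_exp_bound`) with the constants of the title, so
  `|ν_n^{(t)}| ≤ p_n^{(t)}·exp(n·s·a/(1−θ))` whenever `θ < 1`; `n·s·a ≈ ρ|t(t−1)|σ̄²/n` — the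
  `χ²` route's `|t(t−1)|θ_t/(1−θ_t)·σ̄²/n` with `θ_t = ρe^{(5|t|+2|t−1|)ΔD/(4n)}` REPLACED by
  `ρ·e^{O(t²)σ̄²/n²}`.

The MGF envelope and the ESS floor that follow are `Scaling/HypercontractiveESSFloor`.
NOT CLAIMED: any value of `ρ` for a lattice kernel; non-uniform grids.
-/

namespace Summit.Ventures.LatticeQCDFlow.Scaling

open Finset
open Literature.Probability.MarkovChains (stepLaw IsStationary)
open Literature.Probability.ImportanceSampling (chiSqDiv chiSqDiv_def chiSqDiv_eq_sum_sq_div)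
open Summit.Ventures.LatticeQCDFlow.Exactness
open Summit.Ventures.LatticeQCDFlow.Theory2

variable {X : Type*} [Fintype X] [Nonempty X]

/-! ## §0 How `ρ < 1` arises: a contracting layer followed by a hypercontractive one -/

omit [Nonempty X] in
/-- Two layers in succession act on measures as the composed kernel
`(K₁K₂)(x,z) = Σ_y K₁(x,y)K₂(y,z)`: `ξ(K₁K₂) = (ξK₁)K₂`. -/
theorem stepLaw_kernelComp (K₁ K₂ : X → X → ℝ) (ξ : X → ℝ) (z : X) :
    stepLaw (fun x z => ∑ y, K₁ x y * K₂ y z) ξ z = stepLaw K₂ (stepLaw K₁ ξ) z := by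
  unfold stepLaw
  simp_rw [mul_sum, sum_mul]
  rw [sum_comm]
  exact sum_congr rfl fun y _ => sum_congr rfl fun x _ => by ring

omit [Nonempty X] in
/-- **COMPOSITION RULE.**  If `K₁` contracts zero-mass deviations in `L²(1/π)` by `λ`
(`χ²`-contraction / spectral gap; `π` positive) and `K₂` is hypercontractive in the full
sense `Σ_y π(y)((ζK₂)(y)/π(y))⁴ ≤ (Σ_x ζ(x)²/π(x))²` for EVERY `ζ` (`‖K₂‖_{L²(1/π)→L⁴(π)} ≤ 1`, the
property that tensorises), then the layer "`K₁` then `K₂`" satisfies `HyperContracts (K₁K₂) π λ`: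
`m − m₀` contracting sweeps followed by `m₀` hypercontractive ones give `ρ = λ^{m−m₀}`. -/
theorem HyperContracts.of_comp {K₁ K₂ : X → X → ℝ} {π : X → ℝ} {lam : ℝ} (hπ : ∀ x, 0 < π x)
    (hK₁ : ∀ ξ : X → ℝ, ∑ x, ξ x = 0 →
      ∑ y, stepLaw K₁ ξ y ^ 2 / π y ≤ lam ^ 2 * ∑ x, ξ x ^ 2 / π x)
    (hK₂ : ∀ ζ : X → ℝ, ∑ y, π y * (stepLaw K₂ ζ y / π y) ^ 4 ≤ (∑ x, ζ x ^ 2 / π x) ^ 2) :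
    HyperContracts (fun x z => ∑ y, K₁ x y * K₂ y z) π lam := by
  intro ξ hξ
  simp_rw [stepLaw_kernelComp K₁ K₂ ξ]
  refine (hK₂ (stepLaw K₁ ξ)).trans ?_
  have h0 : 0 ≤ ∑ y, stepLaw K₁ ξ y ^ 2 / π y :=
    sum_nonneg fun y _ => div_nonneg (sq_nonneg _) (hπ y).le
  calc (∑ y, stepLaw K₁ ξ y ^ 2 / π y) ^ 2 ≤ (lam ^ 2 * ∑ x, ξ x ^ 2 / π x) ^ 2 :=
        pow_le_pow_left₀ h0 (hK₁ ξ hξ) 2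
    _ = lam ^ 4 * (∑ x, ξ x ^ 2 / π x) ^ 2 := by ring

/-! ## §1 The step coefficients inside the family -/

/-- `e^{Λ_{c,a}(2)} = Z(c+2a)·Z(c)/Z(c+a)²`. -/
theorem exp_stepLogMGF_two (S₀ D : X → ℝ) (c a : ℝ) :
    Real.exp (stepLogMGF S₀ D c a 2)
      = partitionFn (linAction S₀ D (c + 2 * a)) * partitionFn (linAction S₀ D c)
          / partitionFn (linAction S₀ D (c + a)) ^ 2 := by
  have hZ := partitionFn_pos (linAction S₀ D c)
  have hZ1 := partitionFn_pos (linAction S₀ D (c + a))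
  rw [exp_stepLogMGF]
  unfold linFreeEnergy
  rw [exp_two_mul_freeEnergy_sub]
  field_simp

/-- `π_c(x)/π_{c+δ}(x) = e^{δD(x)}·Z(c+δ)/Z(c)`. -/
theorem gibbsLaw_div_gibbsLaw_linAction (S₀ D : X → ℝ) (c δ : ℝ) (x : X) :
    gibbsLaw (linAction S₀ D c) x / gibbsLaw (linAction S₀ D (c + δ)) x
      = Real.exp (δ * D x)
          * (partitionFn (linAction S₀ D (c + δ)) / partitionFn (linAction S₀ D c)) := by
  have hZ := partitionFn_pos (linAction S₀ D c)
  have hZ1 := partitionFn_pos (linAction S₀ D (c + δ))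
  have he : Real.exp (-(S₀ x + c * D x))
      = Real.exp (δ * D x) * Real.exp (-(S₀ x + (c + δ) * D x)) := by
    rw [← Real.exp_add]; congr 1; ring
  unfold gibbsLaw linAction
  rw [he]
  field_simp

/-- **THE HÖLDER COEFFICIENT INSIDE THE FAMILY (partition-function form)**:
`Σ_x g_k(x)⁴π_{c_k}(x)³/π_{c_{k+1}}(x)² = (Z(c_{k+1})/Z(c_k))²·Z(c_k + (4t−2)δ_k)/Z(c_k)`. -/
theorem sum_tWeight_pow_four_eq (t : ℝ) (S₀ D : X → ℝ) (c : ℕ → ℝ) (k : ℕ) :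
    ∑ x, tWeight t D c k x ^ 4 * gibbsLaw (linAction S₀ D (c k)) x ^ 3
        / gibbsLaw (linAction S₀ D (c (k + 1))) x ^ 2
      = (partitionFn (linAction S₀ D (c (k + 1))) / partitionFn (linAction S₀ D (c k))) ^ 2
          * (partitionFn (linAction S₀ D (c k + (4 * t - 2) * (c (k + 1) - c k)))
              / partitionFn (linAction S₀ D (c k))) := by
  set δ := c (k + 1) - c k with hδ
  have hck : c (k + 1) = c k + δ := by rw [hδ]; ring
  rw [← sum_gibbsLaw_linAction_mul_exp S₀ D (c k) ((4 * t - 2) * δ), mul_sum]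
  refine sum_congr rfl fun x _ => ?_
  have hπ' := gibbsLaw_pos (linAction S₀ D (c (k + 1))) x
  have hratio := gibbsLaw_div_gibbsLaw_linAction S₀ D (c k) δ x
  rw [← hck] at hratio
  have h4 : tWeight t D c k x ^ 4 = Real.exp (-(4 * t * δ * D x)) := by
    rw [tWeight, ← hδ, ← Real.exp_nat_mul]; congr 1; push_cast; ring
  have hexp : Real.exp (δ * D x) ^ 2 * Real.exp (-(4 * t * δ * D x))
      = Real.exp (-((4 * t - 2) * δ * D x)) := by
    rw [← Real.exp_nat_mul, ← Real.exp_add]; congr 1; push_cast; ring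
  calc tWeight t D c k x ^ 4 * gibbsLaw (linAction S₀ D (c k)) x ^ 3
          / gibbsLaw (linAction S₀ D (c (k + 1))) x ^ 2
      = gibbsLaw (linAction S₀ D (c k)) x
          * (gibbsLaw (linAction S₀ D (c k)) x / gibbsLaw (linAction S₀ D (c (k + 1))) x) ^ 2
          * tWeight t D c k x ^ 4 := by
        field_simp
    _ = _ := by
        rw [hratio, h4, mul_pow, mul_assoc, mul_assoc, ← mul_assoc (Real.exp (δ * D x) ^ 2),
          mul_comm (Real.exp (δ * D x) ^ 2), mul_assoc, hexp]
        ring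

/-- **… and in log-MGF form**: `Σ_x g_k⁴π_k³/π_{k+1}² = ḡ_k⁴·exp(2Λ_{c_{k+1},(t−1)δ_k}(2)
+ Λ_{c_k,(2t−1)δ_k}(2))` — a free-energy second difference, no supremum. -/
theorem sum_tWeight_pow_four_eq_exp (t : ℝ) (S₀ D : X → ℝ) (c : ℕ → ℝ) (k : ℕ) :
    ∑ x, tWeight t D c k x ^ 4 * gibbsLaw (linAction S₀ D (c k)) x ^ 3
        / gibbsLaw (linAction S₀ D (c (k + 1))) x ^ 2
      = (∑ x, gibbsLaw (linAction S₀ D (c k)) x * tWeight t D c k x) ^ 4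
          * Real.exp (2 * stepLogMGF S₀ D (c (k + 1)) ((t - 1) * (c (k + 1) - c k)) 2
              + stepLogMGF S₀ D (c k) ((2 * t - 1) * (c (k + 1) - c k)) 2) := by
  set δ := c (k + 1) - c k with hδ
  have hck : c (k + 1) = c k + δ := by rw [hδ]; ring
  rw [sum_tWeight_pow_four_eq, tEqFactor_eq, ← hδ, Real.exp_add,
    show (2 : ℝ) * stepLogMGF S₀ D (c (k + 1)) ((t - 1) * δ) 2
      = ((2 : ℕ) : ℝ) * stepLogMGF S₀ D (c (k + 1)) ((t - 1) * δ) 2 by push_cast; ring,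
    Real.exp_nat_mul, exp_stepLogMGF_two, exp_stepLogMGF_two, hck,
    show c k + δ + 2 * ((t - 1) * δ) = c k + (2 * t - 1) * δ by ring,
    show c k + δ + (t - 1) * δ = c k + t * δ by ring,
    show c k + 2 * ((2 * t - 1) * δ) = c k + (4 * t - 2) * δ by ring]
  set Z0 := partitionFn (linAction S₀ D (c k)) with hZ0'
  set Z1 := partitionFn (linAction S₀ D (c k + δ)) with hZ1'
  set Zt := partitionFn (linAction S₀ D (c k + t * δ)) with hZt'
  set Z2 := partitionFn (linAction S₀ D (c k + (2 * t - 1) * δ)) with hZ2'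
  set Z4 := partitionFn (linAction S₀ D (c k + (4 * t - 2) * δ)) with hZ4'
  have hZ0 : 0 < Z0 := partitionFn_pos _
  have hZ1 : 0 < Z1 := partitionFn_pos _
  have hZt : 0 < Zt := partitionFn_pos _
  have hZ2 : 0 < Z2 := partitionFn_pos _
  have hZ4 : 0 < Z4 := partitionFn_pos _
  field_simp

/-- **The Hölder coefficient is harmless**: `(Σ_x g_k⁴π_k³/π_{k+1}²)^{1/4}
≤ ḡ_k·exp((6t²−8t+3)·δ_k²σ̄²/4)` when `Var_c(D) ≤ σ̄²` for all `c`. -/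
theorem sqrt_sqrt_sum_tWeight_pow_four_le (t : ℝ) (S₀ D : X → ℝ) (c : ℕ → ℝ) {σbar : ℝ}
    (hσ : ∀ c', varD S₀ D c' ≤ σbar ^ 2) (k : ℕ) :
    Real.sqrt (Real.sqrt (∑ x, tWeight t D c k x ^ 4 * gibbsLaw (linAction S₀ D (c k)) x ^ 3
        / gibbsLaw (linAction S₀ D (c (k + 1))) x ^ 2))
      ≤ (∑ x, gibbsLaw (linAction S₀ D (c k)) x * tWeight t D c k x)
          * Real.exp ((6 * t ^ 2 - 8 * t + 3) * (c (k + 1) - c k) ^ 2 * σbar ^ 2 / 4) := by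
  set δ := c (k + 1) - c k with hδ
  set gb := ∑ x, gibbsLaw (linAction S₀ D (c k)) x * tWeight t D c k x with hgb
  have hgb0 : 0 ≤ gb := (tEqFactor_pos t S₀ D c k).le
  set E := 2 * stepLogMGF S₀ D (c (k + 1)) ((t - 1) * δ) 2
    + stepLogMGF S₀ D (c k) ((2 * t - 1) * δ) 2 with hE
  have hE' : E ≤ (6 * t ^ 2 - 8 * t + 3) * δ ^ 2 * σbar ^ 2 := by
    have h1 := stepLogMGF_le_of_varD_le S₀ D (c (k + 1)) ((t - 1) * δ) hσ (t := 2)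
      (Or.inr (by norm_num))
    have h2 := stepLogMGF_le_of_varD_le S₀ D (c k) ((2 * t - 1) * δ) hσ (t := 2)
      (Or.inr (by norm_num))
    rw [hE]
    nlinarith [h1, h2, sq_nonneg δ, sq_nonneg σbar, sq_nonneg t]
  have hR0 : 0 ≤ gb * Real.exp ((6 * t ^ 2 - 8 * t + 3) * δ ^ 2 * σbar ^ 2 / 4) := by positivity
  have h4 : (gb * Real.exp ((6 * t ^ 2 - 8 * t + 3) * δ ^ 2 * σbar ^ 2 / 4)) ^ 4
      = gb ^ 4 * Real.exp ((6 * t ^ 2 - 8 * t + 3) * δ ^ 2 * σbar ^ 2) := by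
    rw [mul_pow, ← Real.exp_nat_mul]; congr 2; push_cast; ring
  have hle : ∑ x, tWeight t D c k x ^ 4 * gibbsLaw (linAction S₀ D (c k)) x ^ 3
        / gibbsLaw (linAction S₀ D (c (k + 1))) x ^ 2
      ≤ (gb * Real.exp ((6 * t ^ 2 - 8 * t + 3) * δ ^ 2 * σbar ^ 2 / 4)) ^ 4 := by
    rw [sum_tWeight_pow_four_eq_exp, ← hgb, ← hδ, ← hE, h4]
    exact mul_le_mul_of_nonneg_left (Real.exp_le_exp.mpr hE') (pow_nonneg hgb0 4)
  calc Real.sqrt (Real.sqrt _)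
      ≤ Real.sqrt (Real.sqrt ((gb * Real.exp ((6 * t ^ 2 - 8 * t + 3) * δ ^ 2 * σbar ^ 2 / 4)) ^ 4)) :=
        Real.sqrt_le_sqrt (Real.sqrt_le_sqrt hle)
    _ = gb * Real.exp ((6 * t ^ 2 - 8 * t + 3) * δ ^ 2 * σbar ^ 2 / 4) := by
        rw [show (gb * Real.exp ((6 * t ^ 2 - 8 * t + 3) * δ ^ 2 * σbar ^ 2 / 4)) ^ 4
            = ((gb * Real.exp ((6 * t ^ 2 - 8 * t + 3) * δ ^ 2 * σbar ^ 2 / 4)) ^ 2) ^ 2 by ring,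
          Real.sqrt_sq (pow_nonneg hR0 2), Real.sqrt_sq hR0]

/-! ## §2 The tilted mass along the uniform grid -/

/-- Stationarity of the Gibbs law gives stationarity of the Boltzmann weight (the form
`Exactness/JarzynskiFinite` and `Scaling/PathWorkMoments` take). -/
theorem isStationary_exp_neg_of_gibbsLaw {S : X → ℝ} {P : X → X → ℝ}
    (hst : IsStationary (gibbsLaw S) P) : IsStationary (fun x => Real.exp (-S x)) P := by
  intro y
  have hZ := partitionFn_pos S
  have h := hst y
  unfold gibbsLaw at h
  have h' : (∑ x, Real.exp (-S x) * P x y) / partitionFn S = Real.exp (-S y) / partitionFn S := by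
    rw [← h, sum_div]
    exact sum_congr rfl fun x _ => by ring
  field_simp at h'
  linarith [h', mul_comm (∑ x, Real.exp (-S x) * P x y) (partitionFn S)]

/-- **`t`-TILTED MASS ALONG THE UNIFORM PROTOCOL, HYPERCONTRACTIVE LAYERS.**  With `ε = σ̄²/n²`,
`s = √(e^{t²ε} − 1)`, `a = ρ√(e^{(t−1)²ε} − 1)`, `θ = ρ·e^{(6t²−8t+3)ε/4} < 1`:
`|ν_n^{(t)}| ≤ p_n^{(t)} · exp(n·s·a/(1−θ))`. -/
theorem tTiltMass_uniform_le_hc (t : ℝ) (S₀ D : X → ℝ) (P : ℕ → X → X → ℝ) {n : ℕ} (hn : n ≠ 0)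
    {ρ σbar : ℝ} (hPpos : ∀ k x y, 0 < P k x y) (hProw : ∀ k x, ∑ y, P k x y = 1)
    (hst : ∀ k, IsStationary (gibbsLaw (linAction S₀ D (((k + 1 : ℕ) : ℝ) / n))) (P k))
    (hK : ∀ k, HyperContracts (P k) (gibbsLaw (linAction S₀ D (((k + 1 : ℕ) : ℝ) / n))) ρ)
    (hρ : 0 ≤ ρ) (hσ : ∀ c, varD S₀ D c ≤ σbar ^ 2)
    (hθ1 : ρ * Real.exp ((6 * t ^ 2 - 8 * t + 3) * (σbar ^ 2 / n ^ 2) / 4) < 1) :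
    ∑ x, tTiltLaw t S₀ D (fun k : ℕ => (k : ℝ) / n) P n x
      ≤ tPerfMass t S₀ D (fun k : ℕ => (k : ℝ) / n) n
          * Real.exp (n * (Real.sqrt (Real.exp (t ^ 2 * (σbar ^ 2 / n ^ 2)) - 1)
              * (ρ * Real.sqrt (Real.exp ((t - 1) ^ 2 * (σbar ^ 2 / n ^ 2)) - 1))
              / (1 - ρ * Real.exp ((6 * t ^ 2 - 8 * t + 3) * (σbar ^ 2 / n ^ 2) / 4)))) := by
  set c : ℕ → ℝ := fun k => (k : ℝ) / n with hc
  have hn' : (0 : ℝ) < n := Nat.cast_pos.mpr (Nat.pos_of_ne_zero hn)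
  have hδ : ∀ k, c (k + 1) - c k = 1 / n := by intro k; rw [hc]; simp only; rw [uniform_step]
  have hcs : ∀ k, c (k + 1) = c k + 1 / n := fun k => by linarith [hδ k]
  set ε : ℝ := σbar ^ 2 / n ^ 2 with hε
  have hsqε : ∀ r : ℝ, (r * (1 / n)) ^ 2 * σbar ^ 2 = r ^ 2 * ε := by
    intro r; rw [hε]; field_simp
  -- the two sequences and the constants of the majorant system
  set π : ℕ → X → ℝ := fun k => gibbsLaw (linAction S₀ D (c k)) with hπ
  set ν : ℕ → X → ℝ := fun k => tTiltLaw t S₀ D c P k with hν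
  set m : ℕ → ℝ := fun k => ∑ x, ν k x with hm
  set d : ℕ → ℝ := fun k => dev4 (π k) (ν k) with hd
  set p : ℕ → ℝ := fun k => tPerfMass t S₀ D c k with hp
  set gb : ℕ → ℝ := fun k => ∑ x, π k x * tWeight t D c k x with hgb
  have hπpos : ∀ k x, 0 < π k x := fun k x => gibbsLaw_pos _ x
  have hπ1 : ∀ k, ∑ x, π k x = 1 := fun k => sum_gibbsLaw _
  have hp0 : ∀ k, 0 < p k := fun k => tPerfMass_pos t S₀ D c k
  have hgb0 : ∀ k, 0 < gb k := fun k => tEqFactor_pos t S₀ D c k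
  have hpsucc : ∀ k, p (k + 1) = p k * gb k := fun k => tPerfMass_succ t S₀ D c k
  have hd0 : ∀ k, 0 ≤ d k := fun k => dev4_nonneg _ _
  have hm0 : ∀ k, 0 < m k := fun k => sum_pos (fun x _ => tTiltLaw_pos hPpos k x) univ_nonempty
  set s : ℝ := Real.sqrt (Real.exp (t ^ 2 * ε) - 1) with hs
  set a : ℝ := ρ * Real.sqrt (Real.exp ((t - 1) ^ 2 * ε) - 1) with ha
  set θ : ℝ := ρ * Real.exp ((6 * t ^ 2 - 8 * t + 3) * ε / 4) with hθ
  have hs0 : 0 ≤ s := Real.sqrt_nonneg _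
  have ha0 : 0 ≤ a := mul_nonneg hρ (Real.sqrt_nonneg _)
  have hθ0 : 0 ≤ θ := by positivity
  -- mass step (sup-norm-free, Scaling/TiltedProtocolMass) with massDev ≤ dev4
  have hu : ∀ k, m (k + 1) / p (k + 1) ≤ m k / p k + s * (d k / p k) := by
    intro k
    have step := sum_tTiltLaw_succ_le_of_varD_le t S₀ D c hProw hσ k
    rw [hδ k, hsqε t] at step
    have hmd : massDev (π k) (ν k) ≤ d k := massDev_le_dev4 (hπpos k) (hπ1 k) (ν k)
    have step' : m (k + 1) ≤ gb k * (m k + s * d k) :=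
      step.trans (mul_le_mul_of_nonneg_left (by nlinarith [mul_le_mul_of_nonneg_left hmd hs0])
        (hgb0 k).le)
    have hpk := (hp0 k).ne'
    rw [hpsucc, div_le_iff₀ (mul_pos (hp0 k) (hgb0 k))]
    have e : (m k / p k + s * (d k / p k)) * (p k * gb k) = gb k * (m k + s * d k) := by
      field_simp
    rw [e]
    exact step'
  -- deviation step (hypercontractive, Scaling/HypercontractiveDeviation) with the family values
  have hv : ∀ k, d (k + 1) / p (k + 1) ≤ a * (m k / p k) + θ * (d k / p k) := by
    intro k
    have step := dev4_tilt_stepLaw_le (ν := ν k) (hπpos k) (hπpos (k + 1)) (hπ1 (k + 1))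
      (hgb0 k) (hProw k) (by simpa only [hπ, hc] using hst k) (by simpa only [hπ, hc] using hK k) hρ
    rw [← tTiltLaw_succ] at step
    -- the Hölder coefficient
    have hC := sqrt_sqrt_sum_tWeight_pow_four_le t S₀ D c hσ k
    rw [hδ k, show (6 * t ^ 2 - 8 * t + 3) * (1 / (n : ℝ)) ^ 2 * σbar ^ 2 / 4
        = (6 * t ^ 2 - 8 * t + 3) * ε / 4 by rw [hε]; field_simp] at hC
    -- the tilt-induced χ²
    have hχ : Real.sqrt (chiSqDiv (fun x => π k x * tWeight t D c k x / ∑ y, π k y * tWeight t D c k y)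
          (π (k + 1))) ≤ Real.sqrt (Real.exp ((t - 1) ^ 2 * ε) - 1) := by
      refine Real.sqrt_le_sqrt ?_
      have htilt := tilt_gibbsLaw_eq_t t S₀ D c k
      simp only [hπ]
      rw [htilt, hδ k, hcs k, show c k + t * (1 / (n : ℝ)) = c k + 1 / n + (t - 1) * (1 / n) by ring]
      have h := chiSqDiv_gibbsLaw_linAction_le S₀ D (c k + 1 / n) ((t - 1) * (1 / n)) hσ
      rwa [hsqε (t - 1)] at h
    have habs : |∑ x, ν k x| = m k := abs_of_pos (hm0 k)
    rw [habs] at step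
    have step' : d (k + 1) ≤ ρ * (gb k * Real.exp ((6 * t ^ 2 - 8 * t + 3) * ε / 4) * d k
        + m k * gb k * Real.sqrt (Real.exp ((t - 1) ^ 2 * ε) - 1)) := by
      refine step.trans (mul_le_mul_of_nonneg_left (add_le_add ?_ ?_) hρ)
      · exact mul_le_mul_of_nonneg_right hC (hd0 k)
      · exact mul_le_mul_of_nonneg_left hχ (mul_nonneg (hm0 k).le (hgb0 k).le)
    have hpk := (hp0 k).ne'
    rw [hpsucc, div_le_iff₀ (mul_pos (hp0 k) (hgb0 k))]
    have e : (a * (m k / p k) + θ * (d k / p k)) * (p k * gb k)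
        = ρ * (gb k * Real.exp ((6 * t ^ 2 - 8 * t + 3) * ε / 4) * d k
            + m k * gb k * Real.sqrt (Real.exp ((t - 1) ^ 2 * ε) - 1)) := by
      rw [ha, hθ]; field_simp; ring
    rw [e]
    exact step'
  -- initial values
  have hu0 : m 0 / p 0 ≤ 1 := by
    rw [hm, hp, hν]; simp only
    rw [tTiltLaw_zero, sum_gibbsLaw, tPerfMass, Finset.prod_range_zero, div_one]
  have hv0 : d 0 / p 0 ≤ 0 := by
    rw [hd, hp, hν, hπ]; simp only
    rw [tTiltLaw_zero]
    have h1 := dev4_mul_self (hπpos 0) (hπ1 0) 1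
    simp only [hπ, one_mul] at h1
    rw [h1, zero_div]
  have hθ1' : θ < 1 := hθ1
  have hbound := coupled_majorant_exp_bound (u := fun k => m k / p k) (v := fun k => d k / p k)
    hs0 ha0 hθ0 hθ1' hu0 hv0 hu hv n
  have hfin : m n / p n ≤ Real.exp (n * (s * a / (1 - θ))) := hbound
  calc m n ≤ Real.exp (n * (s * a / (1 - θ))) * p n := (div_le_iff₀ (hp0 n)).mp hfin
    _ = p n * Real.exp (n * (s * a / (1 - θ))) := mul_comm _ _

end Summit.Ventures.LatticeQCDFlow.Scaling
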